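import Literature.Analysis.OperatorTheory.L2KernelHilbertSchmidt
import HarnessLib

/-!
# The Hilbert–Schmidt PAIRING of two `L²`-kernel operators: `Σ_i ⟨A e_i, B e_i⟩ = ∫∫ conj K_A · K_B`
# (Reed–Simon I, Thm. VI.22 (e), VI.23: the isometry `𝒥₂ ≅ L²(μ ⊗ ν)` preserves inner products)

Topic `Literature/Analysis/OperatorTheory`; theorems only (no definition, no named fact, no instance);
continuation of `L2KernelHilbertSchmidt.lean` (`L2Kernel.hasSum_norm_sq_op'`: `Σ_i ‖A e_i‖² = ∫ |K_A|² d(μ ⊗ ν)`).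
By POLARIZATION of that identity (applied to `A ± B`, `A ± i B`, whose kernels are `K_A ± K_B`, `K_A ± i K_B`)
the Hilbert–Schmidt inner product is the `L²(μ ⊗ ν)` inner product of the kernels:

* `L2Kernel.ae_eq_kernel_add_smul` — linear combinations of kernel operators are kernel operators;
* **`L2Kernel.hasSum_inner_op_op`** — for bounded `A, B : L²(Y, ν) → L²(X, μ)` acting a.e. by square-integrable
  kernels `K_A, K_B` and a countable Hilbert basis `(e_i)` of `L²(Y, ν)`:
  `Σ_i ⟨A e_i, B e_i⟩ = ⟨K_A, K_B⟩_{L²(μ ⊗ ν)} = ∫ conj K_A(z) K_B(z) d(μ ⊗ ν)(z)`.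

Used downstream (cell `rh-crit`, Connes 1999 §VII annulus road): the VALUE of a trace of a product of two
Hilbert–Schmidt kernel operators, `Tr(A† B) = ∫∫ conj K_A K_B`.

## References
* M. Reed, B. Simon, *Methods of Modern Mathematical Physics I* (1972), Thm. VI.22 (e), Thm. VI.23
  (PDF pp. 198–199 of the held copy). [ReedSimon1972]
-/

noncomputable section

open MeasureTheory Function Filter
open scoped ENNReal InnerProductSpace ComplexConjugate

namespace Literature.Analysis.OperatorTheory

namespace L2Kernel

variable {X Y : Type*} [MeasurableSpace X] [MeasurableSpace Y] {μ : Measure X} {ν : Measure Y}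
  [SFinite μ] [SFinite ν] {𝕜 : Type*} [RCLike 𝕜] {K₁ K₂ : X → Y → 𝕜}

/-- **Linear combinations of kernel operators are kernel operators**: if `A`, `B` act a.e. by the
square-integrable kernels `K₁`, `K₂`, then `A + c • B` acts a.e. by `K₁ + c K₂`. [cite: ReedSimon1972, Thm. VI.23, PDF pp. 198–199] -/
theorem ae_eq_kernel_add_smul (hK₁ : MemLp (uncurry K₁) 2 (μ.prod ν)) (hK₂ : MemLp (uncurry K₂) 2 (μ.prod ν))
    {A B : Lp 𝕜 2 ν →L[𝕜] Lp 𝕜 2 μ}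
    (hA : ∀ φ : Lp 𝕜 2 ν, (A φ : X → 𝕜) =ᵐ[μ] fun x => ∫ y, K₁ x y * φ y ∂ν)
    (hB : ∀ φ : Lp 𝕜 2 ν, (B φ : X → 𝕜) =ᵐ[μ] fun x => ∫ y, K₂ x y * φ y ∂ν) (c : 𝕜) (φ : Lp 𝕜 2 ν) :
    ((A + c • B) φ : X → 𝕜) =ᵐ[μ] fun x => ∫ y, (K₁ x y + c * K₂ x y) * φ y ∂ν := by
  have h1 := ae_memLp_section hK₁
  have h2 := ae_memLp_section hK₂
  rw [add_apply, smul_apply]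
  filter_upwards [Lp.coeFn_add (A φ) (c • B φ), Lp.coeFn_smul c (B φ), hA φ, hB φ, h1, h2]
    with x hadd hsmul ha hb hx1 hx2
  rw [hadd, Pi.add_apply, hsmul, Pi.smul_apply, ha, hb, smul_eq_mul]
  have i1 : Integrable (fun y => K₁ x y * φ y) ν := hx1.integrable_mul (Lp.memLp φ)
  have i2 : Integrable (fun y => K₂ x y * φ y) ν := hx2.integrable_mul (Lp.memLp φ)
  rw [← integral_const_mul, ← integral_add i1 (i2.const_mul c)]
  refine integral_congr_ae (Eventually.of_forall fun y => ?_)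
  ring

omit [SFinite μ] [SFinite ν] in
/-- The kernel of `A + c • B` is square integrable. [cite: ReedSimon1972, Thm. VI.23, PDF pp. 198–199] -/
theorem memLp_kernel_add_smul (hK₁ : MemLp (uncurry K₁) 2 (μ.prod ν)) (hK₂ : MemLp (uncurry K₂) 2 (μ.prod ν))
    (c : 𝕜) : MemLp (uncurry fun x y => K₁ x y + c * K₂ x y) 2 (μ.prod ν) := by
  have h : (uncurry fun x y => K₁ x y + c * K₂ x y) = uncurry K₁ + fun z => c * uncurry K₂ z := by
    funext z; rfl
  rw [h]
  exact hK₁.add (hK₂.const_mul c)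

/-- `Σ_i ‖(A + c • B) e_i‖² = ‖𝒦₁ + c 𝒦₂‖²` in `L²(μ ⊗ ν)` (the norm identity for the combination). [cite: ReedSimon1972, Thm. VI.23, PDF pp. 198–199] -/
theorem hasSum_norm_sq_add_smul {ι : Type*} [Countable ι] (hK₁ : MemLp (uncurry K₁) 2 (μ.prod ν))
    (hK₂ : MemLp (uncurry K₂) 2 (μ.prod ν)) {A B : Lp 𝕜 2 ν →L[𝕜] Lp 𝕜 2 μ}
    (hA : ∀ φ : Lp 𝕜 2 ν, (A φ : X → 𝕜) =ᵐ[μ] fun x => ∫ y, K₁ x y * φ y ∂ν)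
    (hB : ∀ φ : Lp 𝕜 2 ν, (B φ : X → 𝕜) =ᵐ[μ] fun x => ∫ y, K₂ x y * φ y ∂ν) (c : 𝕜)
    (b : HilbertBasis ι 𝕜 (Lp 𝕜 2 ν)) :
    HasSum (fun i => ‖A (b i) + c • B (b i)‖ ^ 2)
      (‖hK₁.toLp (uncurry K₁) + c • hK₂.toLp (uncurry K₂)‖ ^ 2) := by
  have h := hasSum_norm_sq_op' (memLp_kernel_add_smul hK₁ hK₂ c) (ae_eq_kernel_add_smul hK₁ hK₂ hA hB c) b
  have hval : ∫ z, ‖uncurry (fun x y => K₁ x y + c * K₂ x y) z‖ ^ 2 ∂(μ.prod ν) =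
      ‖hK₁.toLp (uncurry K₁) + c • hK₂.toLp (uncurry K₂)‖ ^ 2 := by
    rw [← MemLp.toLp_const_smul, ← MemLp.toLp_add, norm_toLp_sq_eq_integral_norm_sq]
    rfl
  rw [← hval]
  refine h.congr_fun fun i => ?_
  rw [add_apply, smul_apply]

/-- **The Hilbert–Schmidt pairing of two kernel operators is the `L²(μ ⊗ ν)` pairing of their kernels**:
`Σ_i ⟨A e_i, B e_i⟩ = ⟨𝒦_A, 𝒦_B⟩_{L²(μ ⊗ ν)}` (`HasSum`), by polarization of Reed–Simon VI.23. [cite: ReedSimon1972, Thm. VI.22 (e), Thm. VI.23, PDF pp. 198–199] -/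
theorem hasSum_inner_op_op {ι : Type*} [Countable ι] (hK₁ : MemLp (uncurry K₁) 2 (μ.prod ν))
    (hK₂ : MemLp (uncurry K₂) 2 (μ.prod ν)) {A B : Lp 𝕜 2 ν →L[𝕜] Lp 𝕜 2 μ}
    (hA : ∀ φ : Lp 𝕜 2 ν, (A φ : X → 𝕜) =ᵐ[μ] fun x => ∫ y, K₁ x y * φ y ∂ν)
    (hB : ∀ φ : Lp 𝕜 2 ν, (B φ : X → 𝕜) =ᵐ[μ] fun x => ∫ y, K₂ x y * φ y ∂ν)
    (b : HilbertBasis ι 𝕜 (Lp 𝕜 2 ν)) :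
    HasSum (fun i => ⟪A (b i), B (b i)⟫_𝕜) ⟪hK₁.toLp (uncurry K₁), hK₂.toLp (uncurry K₂)⟫_𝕜 := by
  set u := hK₁.toLp (uncurry K₁)
  set v := hK₂.toLp (uncurry K₂)
  -- the four polarization series
  have h1 := hasSum_norm_sq_add_smul hK₁ hK₂ hA hB (1 : 𝕜) b
  have h2 := hasSum_norm_sq_add_smul hK₁ hK₂ hA hB (-1 : 𝕜) b
  have h3 := hasSum_norm_sq_add_smul hK₁ hK₂ hA hB (-(RCLike.I : 𝕜)) b
  have h4 := hasSum_norm_sq_add_smul hK₁ hK₂ hA hB (RCLike.I : 𝕜) b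
  simp only [one_smul, neg_smul, ← sub_eq_add_neg] at h1 h2 h3 h4
  -- move to `𝕜` and combine
  have h1' := (RCLike.hasSum_ofReal 𝕜).mpr h1
  have h2' := (RCLike.hasSum_ofReal 𝕜).mpr h2
  have h3' := (RCLike.hasSum_ofReal 𝕜).mpr h3
  have h4' := (RCLike.hasSum_ofReal 𝕜).mpr h4
  have hc := ((h1'.sub h2').add ((h3'.sub h4').mul_right (RCLike.I : 𝕜))).div_const 4
  simp only [RCLike.ofReal_pow] at hc
  convert hc using 1
  · funext i
    exact inner_eq_sum_norm_sq_div_four (A (b i)) (B (b i))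
  · exact inner_eq_sum_norm_sq_div_four u v

/-- The same with the right-hand side as an integral: `Σ_i ⟨A e_i, B e_i⟩ = ∫ conj K_A(z) K_B(z) d(μ ⊗ ν)(z)`. [cite: ReedSimon1972, Thm. VI.22 (e), Thm. VI.23, PDF pp. 198–199] -/
theorem hasSum_inner_op_op_integral {ι : Type*} [Countable ι] (hK₁ : MemLp (uncurry K₁) 2 (μ.prod ν))
    (hK₂ : MemLp (uncurry K₂) 2 (μ.prod ν)) {A B : Lp 𝕜 2 ν →L[𝕜] Lp 𝕜 2 μ}
    (hA : ∀ φ : Lp 𝕜 2 ν, (A φ : X → 𝕜) =ᵐ[μ] fun x => ∫ y, K₁ x y * φ y ∂ν)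
    (hB : ∀ φ : Lp 𝕜 2 ν, (B φ : X → 𝕜) =ᵐ[μ] fun x => ∫ y, K₂ x y * φ y ∂ν)
    (b : HilbertBasis ι 𝕜 (Lp 𝕜 2 ν)) :
    HasSum (fun i => ⟪A (b i), B (b i)⟫_𝕜) (∫ z, conj (uncurry K₁ z) * uncurry K₂ z ∂(μ.prod ν)) := by
  have h := hasSum_inner_op_op hK₁ hK₂ hA hB b
  have hval : ⟪hK₁.toLp (uncurry K₁), hK₂.toLp (uncurry K₂)⟫_𝕜 =
      ∫ z, conj (uncurry K₁ z) * uncurry K₂ z ∂(μ.prod ν) := by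
    rw [L2.inner_def]
    refine integral_congr_ae ?_
    filter_upwards [hK₁.coeFn_toLp, hK₂.coeFn_toLp] with z h1 h2
    rw [h1, h2, RCLike.inner_apply, mul_comm]
  rwa [hval] at h

end L2Kernel

end Literature.Analysis.OperatorTheory
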